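import Mathlib.Combinatorics.SimpleGraph.Walk.Counting
import Mathlib.Combinatorics.SimpleGraph.Paths
import Mathlib.Combinatorics.SimpleGraph.Operations
import Mathlib.Topology.Algebra.InfiniteSum.ENNReal
import Summits.CriticalPhenomena.SAWScalingLimit.Theorems.SAWTotalPositivityBoundaryTP2Defs
import Summits.CriticalPhenomena.SAWScalingLimit.Theorems.SAWTotalPositivityBoundaryTP2Kernel
import Summits.CriticalPhenomena.SAWScalingLimit.Theorems.SAWTotalPositivityBoundaryTP2Symmetry
import Summits.CriticalPhenomena.SAWScalingLimit.Theorems.SAWTotalPositivityBoundaryTP2FirstStep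
import Summits.CriticalPhenomena.SAWScalingLimit.Theorems.SAWTotalPositivityBoundaryTP2Avoid
import Summits.CriticalPhenomena.SAWScalingLimit.Theorems.SAWTotalPositivityBoundaryTP2SquareGadget
import Summits.CriticalPhenomena.SAWScalingLimit.Theorems.SAWTotalPositivityBoundaryTP2CutVertex
import Summits.CriticalPhenomena.SAWScalingLimit.Theorems.SAWLeftRightFKGLeftRightFKGInterlacedOfGraphTP2
import Summits.CriticalPhenomena.SAWScalingLimit.Theorems.SAWLeftRightFKGLeftRightFKGStubVisitDeg2
import HarnessLib

/-!
# Crux `LeftRightFKG` (stmt-CriticalPhenomena-11232), line `corner-localisation` (skeleton v8):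
the blob gadget `stub_blobGadget`

For the fugacity-`x` self-avoiding path kernel `Z_H = BoundaryTP2.pathKernel H x` of a finite `H ≤ ℤ²`,
`0 < x < 1`, the combinatorial core `GraphTP2At x` and the degree-two visiting identity (the line's
`stub_visitDeg2`, taken here as a hypothesis) give the BRACKET of a one-vertex cut without any three-point
hypothesis. Cut data: `V = A ∪ B`, `A ∩ B = {z}`, every edge of `H` inside `A` or inside `B`
(as in `BoundaryTP2.stub_cutVertex_factor`); `u ≠ w` in `A`, `u'` in `B`, all three `≠ z`; an isolated
vertex `p` of `H` lattice-adjacent to `u` and to `u'`; `Z(z,u') ≠ 0`; `u, w` connected in `H - z` and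
`w, z` connected in `H - u`. Then `Z_A(u,z) · Z_A(w,z) ≤ Z_H(u,w)` (`Z_A` the kernel of the `A`-piece
`SimpleGraph.fromRel (fun a b => H.Adj a b ∧ a ∈ A ∧ b ∈ A)`).

PROOF (the *blob gadget*). Hang the two lattice edges `u p`, `p u'` on `H`, obtaining `G ≤ ℤ²` with
`N_G(p) = {u, u'}` and `G - p = H`. Write `a = Z_A(u,z)`, `b = Z_A(w,z)`, `c = Z(u,w)`, `β = Z(z,u')`.
The cut-vertex factorisation gives `Z(u,z) = a`, `Z(w,z) = b`, `Z(u',w) = b β`, and every self-avoiding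
`H`-path `u' → z` avoids `u` (it stays in `B`), so `Z_{H-u}(u',z) = β`. First-step decompositions at `p`
and the visiting identity at `p` evaluate the gadget kernels: `Z_G(p,z) = x (a + β)`,
`Z_G(p,w) = x (c + b β)`, `Z_G(u,z) = a + x² β`, `Z_G(u,w) ≤ c + x² b β`. The quadruple `(u, w, z, p)`
of `G` is interlaced (a path into `p` arrives from `u`, or from `u'` after crossing the cut at `z`) and
both nested pairings are disjointly realisable (`u → w` inside `A ∖ {z}` with `z → u' p` inside
`B ∪ {p}`; the edge `u p` with `w → z` avoiding `u`), so `GraphTP2At x` gives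
`(a + x²β) · x(c + bβ) ≤ (c + x²bβ) · x(a + β)`, i.e. `x β (1 - x²) (ab - c) ≤ 0`, whence `ab ≤ c`.
Everything here is proved; Mathlib, the sibling toolkit and `deleteEdges_incidenceSet_union_adj`
(`…StubVisitDeg2.lean`) only. [folklore]
-/

noncomputable section
open Literature.Probability.LatticeModels
open Summit.CriticalPhenomena.SAWScalingLimit.Theorems.BoundaryTP2
open scoped ENNReal

namespace Summit.CriticalPhenomena.SAWScalingLimit.Theorems.LeftRightFKG.CornerGadget

variable {V : Type*}

/-! ## Walk lemmas at a one-vertex cut -/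

/-- STAY-IN-`B`. Under cut data (`A ∩ B ⊆ {z}`, every edge whose ends satisfy `Q` lies inside `A` or
inside `B`, and `Q v → v ≠ z`), a walk all of whose vertices satisfy `Q` and which starts in `B` stays
in `B`: an edge leaving `B` would start at a vertex of `A ∩ B = {z}`. [folklore] -/
theorem stay_of_cut {G : SimpleGraph V} {A B : Set V} {z : V} {Q : V → Prop}
    (hc : ∀ v, v ∈ A → v ∈ B → v = z) (hQ : ∀ v, Q v → v ≠ z)
    (hsep : ∀ a b, G.Adj a b → Q a → Q b → (a ∈ A ∧ b ∈ A) ∨ (a ∈ B ∧ b ∈ B)) :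
    ∀ {a b : V} (q : G.Walk a b), (∀ v, v ∈ q.support → Q v) → a ∈ B →
      ∀ v, v ∈ q.support → v ∈ B := by
  intro a b q
  induction q with
  | nil =>
    intro _ ha v hv
    rw [SimpleGraph.Walk.support_nil, List.mem_singleton] at hv
    subst hv
    exact ha
  | cons h q' ih =>
    intro hq ha v hv
    have h0 := hq _ (SimpleGraph.Walk.start_mem_support _)
    have hq' : ∀ v, v ∈ q'.support → Q v := fun v hv =>
      hq v (by rw [SimpleGraph.Walk.support_cons]; exact List.mem_cons_of_mem _ hv)
    rw [SimpleGraph.Walk.support_cons, List.mem_cons] at hv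
    rcases hv with rfl | hv
    · exact ha
    · refine ih hq' ?_ v hv
      rcases hsep _ _ h h0 (hq' _ q'.start_mem_support) with ⟨h0A, -⟩ | ⟨-, h1B⟩
      · exact absurd (hc _ h0A ha) (hQ _ h0)
      · exact h1B

/-- FROM THE CUT VERTEX INTO `B`. Under cut data, a self-avoiding path from `z` to a vertex of `B` has
all its vertices in `B` (its part after `z` avoids `z`, reversed it starts in `B`, so it stays in `B`).
[folklore] -/
theorem support_mem_of_isPath_from_cut {G : SimpleGraph V} {A B : Set V} {z : V}
    (hc : ∀ v, v ∈ A → v ∈ B → v = z)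
    (hsep : ∀ a b, G.Adj a b → (a ∈ A ∧ b ∈ A) ∨ (a ∈ B ∧ b ∈ B)) (hzB : z ∈ B)
    {b : V} (ω : G.Walk z b) (hω : ω.IsPath) (hb : b ∈ B) : ∀ v, v ∈ ω.support → v ∈ B := by
  cases ω with
  | nil =>
    intro v hv
    rw [SimpleGraph.Walk.support_nil, List.mem_singleton] at hv
    subst hv
    exact hzB
  | cons h ω₁ =>
    rw [SimpleGraph.Walk.cons_isPath_iff] at hω
    intro v hv
    rw [SimpleGraph.Walk.support_cons, List.mem_cons] at hv
    rcases hv with rfl | hv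
    · exact hzB
    · have hrev : ∀ v, v ∈ ω₁.reverse.support → v ≠ z := fun v hv hvz => hω.2 (by
        rw [SimpleGraph.Walk.support_reverse, List.mem_reverse] at hv; exact hvz ▸ hv)
      exact stay_of_cut (Q := fun v => v ≠ z) hc (fun v hv => hv) (fun a b h _ _ => hsep a b h)
        ω₁.reverse hrev hb v (by rw [SimpleGraph.Walk.support_reverse, List.mem_reverse]; exact hv)

/-! ## The blob gadget -/

/-- REGISTERED STUB `stub_blobGadget` of line `corner-localisation` (skeleton v8): the BLOB GADGET. From
`GraphTP2At x` (`0 < x < 1`) and the degree-two visiting identity (hypothesis; the line's `stub_visitDeg2`):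
if `z` is a one-vertex cut of `H` (cut data `A`, `B` as in `BoundaryTP2.stub_cutVertex_factor`) with
`u ≠ w` in `A`, `u'` in `B`, all three different from `z`, `p` isolated and lattice-adjacent to `u` and `u'`,
`Z_H(z,u') ≠ 0`, `u, w` connected in `H − z` and `w, z` connected in `H − u`, then the `A`-side bracket
holds: `Z_A(u,z) Z_A(w,z) ≤ Z_H(u,w)`. See the module docstring for the proof. [folklore] -/
theorem stub_blobGadget : ∀ x : ℝ, 0 < x → x < 1 → GraphTP2At x →
    (∀ (G : SimpleGraph (Site 2)) (x : ℝ) (c s r t : Site 2), 0 ≤ x →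
      G.neighborSet c = {s, r} → s ≠ r → t ≠ c → t ≠ s →
      pathKernelOn G x s t {γ | c ∈ γ.1.support} =
        ENNReal.ofReal (x ^ 2) * pathKernel (G.deleteEdges (G.incidenceSet c ∪ G.incidenceSet s)) x r t) →
    ∀ (H : SimpleGraph (Site 2)), H ≤ zdGraph 2 → H.support.Finite →
    ∀ (A B : Set (Site 2)) (z u w u' p : Site 2),
      (∀ v, v ∈ A ∨ v ∈ B) → (∀ v, v ∈ A → v ∈ B → v = z) → z ∈ A → z ∈ B →
      (∀ a b, H.Adj a b → (a ∈ A ∧ b ∈ A) ∨ (a ∈ B ∧ b ∈ B)) →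
      u ∈ A → w ∈ A → u' ∈ B → z ≠ u → z ≠ w → z ≠ u' → u ≠ w →
      p ∉ H.support → (zdGraph 2).Adj u p → (zdGraph 2).Adj p u' →
      pathKernel H x z u' ≠ 0 →
      (H.deleteEdges (H.incidenceSet z)).Reachable u w → (H.deleteEdges (H.incidenceSet u)).Reachable w z →
      pathKernel (SimpleGraph.fromRel fun a b => H.Adj a b ∧ a ∈ A ∧ b ∈ A) x u z *
        pathKernel (SimpleGraph.fromRel fun a b => H.Adj a b ∧ a ∈ A ∧ b ∈ A) x w z ≤ pathKernel H x u w := by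
  intro x hx0 hx1 h hV H hH hfin A B z u w u' p hAB hc hzA hzB hsep huA hwA hu'B hzu hzw hzu' huw
    hp hup hpu' hβ hr1 hr2
  classical
  have hxle : 0 ≤ x := hx0.le
  -- membership and distinctness
  have hc' : ∀ v, v ∈ B → v ∈ A → v = z := fun v hB hA => hc v hA hB
  have huB : u ∉ B := fun h' => hzu (hc u huA h').symm
  have hwB : w ∉ B := fun h' => hzw (hc w hwA h').symm
  have hu'A : u' ∉ A := fun h' => hzu' (hc u' h' hu'B).symm
  have huu' : u ≠ u' := fun e => hu'A (e ▸ huA)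
  have hup_ne : u ≠ p := hup.ne
  have hu'p_ne : u' ≠ p := hpu'.ne.symm
  have hHp : ∀ v, ¬ H.Adj p v := fun v hv => hp ⟨v, hv⟩
  have hne_p : ∀ {a : Site 2}, a ∈ H.support → a ≠ p := fun ha e => hp (e ▸ ha)
  -- walks witnessing the reachability hypotheses
  obtain ⟨ωz⟩ : H.Reachable z u' := by
    by_contra hnr; exact hβ (pathKernel_eq_zero_of_not_reachable H x hnr)
  obtain ⟨ω1⟩ := hr1
  obtain ⟨ω2⟩ := hr2
  have hzp : z ≠ p := by
    obtain ⟨v, hv⟩ := exists_adj_of_walk_ne ωz hzu'; exact hne_p ⟨v, hv⟩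
  have hwp : w ≠ p := by
    obtain ⟨v, hv⟩ := exists_adj_of_walk_ne ω2 hzw.symm; exact hne_p ⟨v, SimpleGraph.deleteEdges_le _ hv⟩
  -- the gadget graph
  obtain ⟨G, hG⟩ : ∃ G : SimpleGraph (Site 2),
      G = H ⊔ SimpleGraph.edge u p ⊔ SimpleGraph.edge p u' := ⟨_, rfl⟩
  have hGadj : ∀ a b, G.Adj a b ↔ H.Adj a b ∨ ((a = u ∧ b = p ∨ a = p ∧ b = u) ∧ a ≠ b) ∨
      ((a = p ∧ b = u' ∨ a = u' ∧ b = p) ∧ a ≠ b) := by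
    intro a b; rw [hG]; simp only [SimpleGraph.sup_adj, SimpleGraph.edge_adj, or_assoc]
  have hle : H ≤ G := by rw [hG]; exact le_sup_left.trans le_sup_left
  have hGzd : G ≤ zdGraph 2 := by
    rw [hG]
    refine sup_le (sup_le hH ?_) ?_
    · exact (SimpleGraph.edge_le_iff _).2 (Or.inr hup)
    · exact (SimpleGraph.edge_le_iff _).2 (Or.inr hpu')
  have hGup : G.Adj u p := (hGadj u p).2 (Or.inr (Or.inl ⟨Or.inl ⟨rfl, rfl⟩, hup_ne⟩))
  have hGpu' : G.Adj p u' := (hGadj p u').2 (Or.inr (Or.inr ⟨Or.inl ⟨rfl, rfl⟩, hu'p_ne.symm⟩))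
  -- `G`-edges away from `p` are `H`-edges, and conversely
  have hGH : ∀ a b, G.Adj a b → a ≠ p → b ≠ p → H.Adj a b := by
    intro a b hab hap hbp
    rcases (hGadj a b).1 hab with h' | ⟨h', -⟩ | ⟨h', -⟩
    · exact h'
    · rcases h' with ⟨-, h2⟩ | ⟨h1, -⟩
      · exact absurd h2 hbp
      · exact absurd h1 hap
    · rcases h' with ⟨h1, -⟩ | ⟨-, h2⟩
      · exact absurd h1 hap
      · exact absurd h2 hbp
  have hHG : ∀ a b, H.Adj a b → G.Adj a b ∧ a ≠ p ∧ b ≠ p := fun a b hab =>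
    ⟨hle hab, hne_p ⟨b, hab⟩, hne_p ⟨a, hab.symm⟩⟩
  -- the neighbourhood of `p`
  have hNp : ∀ v, G.Adj p v ↔ v = u ∨ v = u' := by
    intro v
    constructor
    · intro hv
      rcases (hGadj p v).1 hv with h' | ⟨h', -⟩ | ⟨h', -⟩
      · exact (hHp v h').elim
      · rcases h' with ⟨h1, -⟩ | ⟨-, h2⟩
        · exact absurd h1.symm hup_ne
        · exact Or.inl h2
      · rcases h' with ⟨-, h2⟩ | ⟨h1, -⟩
        · exact Or.inr h2
        · exact absurd h1.symm hu'p_ne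
    · rintro (rfl | rfl)
      · exact hGup.symm
      · exact hGpu'
  have hN : G.neighborSet p = {u, u'} := by
    ext v
    rw [SimpleGraph.mem_neighborSet, hNp v, Set.mem_insert_iff, Set.mem_singleton_iff]
  -- `G - p = H` and `G - p - u = H - u`
  have hGp : G.deleteEdges (G.incidenceSet p) = H := by
    ext a b
    rw [deleteEdges_incidenceSet_adj]
    constructor
    · rintro ⟨hab, hap, hbp⟩
      exact hGH a b hab hap hbp
    · exact hHG a b
  have hGpu : G.deleteEdges (G.incidenceSet p ∪ G.incidenceSet u) =
      H.deleteEdges (H.incidenceSet u) := by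
    ext a b
    rw [deleteEdges_incidenceSet_union_adj, deleteEdges_incidenceSet_adj]
    constructor
    · rintro ⟨hab, hap, hbp, hau, hbu⟩
      exact ⟨hGH a b hab hap hbp, hau, hbu⟩
    · rintro ⟨hab, hau, hbu⟩
      obtain ⟨h1, h2, h3⟩ := hHG a b hab
      exact ⟨h1, h2, h3, hau, hbu⟩
  have hGfin : G.support.Finite := by
    refine (hfin.union (((Set.finite_singleton u').insert p).insert u)).subset ?_
    rintro a ⟨b, hab⟩
    rcases (hGadj a b).1 hab with h' | ⟨h', -⟩ | ⟨h', -⟩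
    · exact Or.inl ⟨b, h'⟩
    · right; rcases h' with ⟨rfl, -⟩ | ⟨rfl, -⟩ <;> simp
    · right; rcases h' with ⟨rfl, -⟩ | ⟨rfl, -⟩ <;> simp
  -- stay lemmas in the gadget graph (walks avoiding `z` and `p`) and in `H`
  have hsepG : ∀ a b, G.Adj a b → (a ≠ z ∧ a ≠ p) → (b ≠ z ∧ b ≠ p) →
      (a ∈ A ∧ b ∈ A) ∨ (a ∈ B ∧ b ∈ B) := fun a b hab ha hb => hsep a b (hGH a b hab ha.2 hb.2)
  have stayB : ∀ {a b : Site 2} (q : G.Walk a b), (∀ v, v ∈ q.support → v ≠ z ∧ v ≠ p) → a ∈ B →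
      ∀ v, v ∈ q.support → v ∈ B := fun q hq ha =>
    stay_of_cut (Q := fun v => v ≠ z ∧ v ≠ p) hc (fun v hv => hv.1) hsepG q hq ha
  have stayA : ∀ {a b : Site 2} (q : G.Walk a b), (∀ v, v ∈ q.support → v ≠ z ∧ v ≠ p) → a ∈ A →
      ∀ v, v ∈ q.support → v ∈ A := fun q hq ha =>
    stay_of_cut (Q := fun v => v ≠ z ∧ v ≠ p) hc' (fun v hv => hv.1)
      (fun a b h qa qb => (hsepG a b h qa qb).symm) q hq ha
  have hzpath : ∀ (ω : H.Walk z u'), ω.IsPath → ∀ v, v ∈ ω.support → v ∈ B := fun ω hω =>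
    support_mem_of_isPath_from_cut hc hsep hzB ω hω hu'B
  -- every self-avoiding `H`-path `u' → z` avoids `u`: `Z_{H-u}(u',z) = Z(u',z)`
  have hKu : pathKernel (H.deleteEdges (H.incidenceSet u)) x u' z = pathKernel H x u' z := by
    rw [← stub_pathKernelOn_avoid H x u' z u huu'.symm hzu]
    unfold pathKernelOn pathKernel
    refine tsum_congr fun γ => ?_
    rw [Set.indicator_of_mem]
    intro huγ
    exact huB (hzpath γ.1.reverse γ.2.reverse u
      (by rw [SimpleGraph.Walk.support_reverse, List.mem_reverse]; exact huγ))
  -- the two pieces and the cut-vertex factorisations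
  obtain ⟨GA, hGA⟩ : ∃ GA : SimpleGraph (Site 2),
      GA = SimpleGraph.fromRel fun a b => H.Adj a b ∧ a ∈ A ∧ b ∈ A := ⟨_, rfl⟩
  obtain ⟨GB, hGB⟩ : ∃ GB : SimpleGraph (Site 2),
      GB = SimpleGraph.fromRel fun a b => H.Adj a b ∧ a ∈ B ∧ b ∈ B := ⟨_, rfl⟩
  rw [← hGA]
  have hF : ∀ s t, s ∈ A → t ∈ B → pathKernel H x s t = pathKernel GA x s z * pathKernel GB x z t := by
    intro s t hs ht
    rw [hGA, hGB]
    exact stub_cutVertex_factor H x hxle A B z s t hAB hc hzA hzB hsep hs ht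
  have F1 : pathKernel H x u z = pathKernel GA x u z := by rw [hF u z huA hzB, pathKernel_self, mul_one]
  have F3 : pathKernel H x u' w = pathKernel GA x w z * pathKernel H x z u' := by
    rw [pathKernel_comm H x u' w, hF w u' hwA hu'B, hF z u' hzA hu'B, pathKernel_self, one_mul]
  -- the four gadget kernels
  have K1 : pathKernel G x p z = ENNReal.ofReal x * (pathKernel GA x u z + pathKernel H x z u') := by
    rw [pathKernel_firstStep_pair G x hxle hzp.symm huu' hN, hGp, F1, pathKernel_comm H x u' z]
  have K2 : pathKernel G x p w =
      ENNReal.ofReal x * (pathKernel H x u w + pathKernel GA x w z * pathKernel H x z u') := by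
    rw [pathKernel_firstStep_pair G x hxle hwp.symm huu' hN, hGp, F3]
  have K3 : pathKernel G x u z = pathKernel GA x u z + ENNReal.ofReal (x ^ 2) * pathKernel H x z u' := by
    rw [← pathKernelOn_add_compl (H := G) x u z {γ | p ∈ γ.1.support}, Set.compl_setOf,
      hV G x p u u' z hxle hN huu' hzp hzu, hGpu, hKu, pathKernel_comm H x u' z,
      stub_pathKernelOn_avoid G x u z p hup_ne hzp, hGp, F1, add_comm]
  have K4 : pathKernel G x u w ≤ pathKernel H x u w +
      ENNReal.ofReal (x ^ 2) * (pathKernel GA x w z * pathKernel H x z u') := by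
    rw [← pathKernelOn_add_compl (H := G) x u w {γ | p ∈ γ.1.support}, Set.compl_setOf,
      hV G x p u u' w hxle hN huu' hwp huw.symm, hGpu,
      stub_pathKernelOn_avoid G x u w p hup_ne hwp, hGp, add_comm, ← F3]
    exact add_le_add le_rfl (mul_le_mul' le_rfl (pathKernel_mono (SimpleGraph.deleteEdges_le _) x u' w))
  -- hypotheses of the core for the quadruple `(u, w, z, p)` of `G`
  have hI : Interlaced G u w z p := by
    intro P Q
    obtain ⟨y, hadj, q, hq⟩ := SimpleGraph.Walk.exists_eq_cons_of_ne hwp.symm Q.1.reverse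
    have hQpath := Q.2.reverse
    rw [hq, SimpleGraph.Walk.cons_isPath_iff] at hQpath
    have hqQ : ∀ v, v ∈ q.support → v ∈ Q.1.support := fun v hv => by
      have hmem : v ∈ Q.1.reverse.support := by
        rw [hq, SimpleGraph.Walk.support_cons]; exact List.mem_cons_of_mem _ hv
      rwa [SimpleGraph.Walk.support_reverse, List.mem_reverse] at hmem
    rcases (hNp y).1 hadj with rfl | rfl
    · exact ⟨_, P.1.start_mem_support, hqQ _ q.start_mem_support⟩
    · refine ⟨z, P.1.end_mem_support, hqQ z ?_⟩
      by_contra hzq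
      have hq' : ∀ v, v ∈ q.support → v ≠ z ∧ v ≠ p := fun v hv =>
        ⟨fun e => hzq (e ▸ hv), fun e => hQpath.2 (e ▸ hv)⟩
      exact hwB (stayB q hq' hu'B w q.end_mem_support)
  have hD1 : DisjointPaths G u w z p := by
    -- first path: `u → w` inside `A ∖ {z}`, from `H - z`
    have hP₁ : ∀ v, v ∈ ω1.toPath.1.support → v ≠ z ∧ v ≠ p := by
      intro v hv
      rcases mem_support_walk ω1.toPath.1 v hv with rfl | ⟨b, hb⟩
      · exact ⟨hzu.symm, hup_ne⟩
      · have hb' := (deleteEdges_incidenceSet_adj H z _ b).1 hb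
        exact ⟨hb'.2.1, hne_p ⟨b, hb'.1⟩⟩
    have heP : ∀ e, e ∈ ω1.toPath.1.edges → e ∈ G.edgeSet := fun e he =>
      SimpleGraph.edgeSet_mono ((SimpleGraph.deleteEdges_le _).trans hle) (ω1.toPath.1.edges_subset_edgeSet he)
    have hP₁' : ∀ v, v ∈ (ω1.toPath.1.transfer G heP).support → v ≠ z ∧ v ≠ p := fun v hv =>
      hP₁ v (by rwa [SimpleGraph.Walk.support_transfer] at hv)
    have hP₁A := stayA (ω1.toPath.1.transfer G heP) hP₁' huA
    -- second path: `z → u'` inside `B`, then the edge `u' p`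
    have hρB : ∀ v, v ∈ ωz.toPath.1.support → v ∈ B := hzpath ωz.toPath.1 ωz.toPath.2
    have hρp : p ∉ ωz.toPath.1.support := fun hv => by
      rcases mem_support_walk ωz.toPath.1 p hv with e | hv'
      · exact hzp e.symm
      · exact hp hv'
    have heρ : ∀ e, e ∈ ωz.toPath.1.edges → e ∈ G.edgeSet := fun e he =>
      SimpleGraph.edgeSet_mono hle (ωz.toPath.1.edges_subset_edgeSet he)
    have hρ'p : p ∉ (ωz.toPath.1.transfer G heρ).support := by
      rw [SimpleGraph.Walk.support_transfer]; exact hρp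
    refine ⟨⟨ω1.toPath.1.transfer G heP, ω1.toPath.2.transfer _⟩,
      ⟨(ωz.toPath.1.transfer G heρ).concat hGpu'.symm, (ωz.toPath.2.transfer _).concat hρ'p _⟩, ?_⟩
    intro v hv1 hv2
    obtain ⟨hvz, hvp⟩ := hP₁' v hv1
    rw [SimpleGraph.Walk.support_concat, List.mem_append, List.mem_singleton,
      SimpleGraph.Walk.support_transfer] at hv2
    rcases hv2 with hv2 | hv2
    · exact hvz (hc v (hP₁A v hv1) (hρB v hv2))
    · exact hvp hv2
  have hD2 : DisjointPaths G u p w z := by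
    have hQ₃ : ∀ v, v ∈ ω2.toPath.1.support → v ≠ u ∧ v ≠ p := by
      intro v hv
      rcases mem_support_walk ω2.toPath.1 v hv with rfl | ⟨b, hb⟩
      · exact ⟨huw.symm, hwp⟩
      · have hb' := (deleteEdges_incidenceSet_adj H u _ b).1 hb
        exact ⟨hb'.2.1, hne_p ⟨b, hb'.1⟩⟩
    have heQ : ∀ e, e ∈ ω2.toPath.1.edges → e ∈ G.edgeSet := fun e he =>
      SimpleGraph.edgeSet_mono ((SimpleGraph.deleteEdges_le _).trans hle) (ω2.toPath.1.edges_subset_edgeSet he)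
    refine ⟨SimpleGraph.Path.singleton hGup, ⟨ω2.toPath.1.transfer G heQ, ω2.toPath.2.transfer _⟩, ?_⟩
    simp only [SimpleGraph.Path.singleton_coe, SimpleGraph.Walk.support_cons,
      SimpleGraph.Walk.support_nil, SimpleGraph.Walk.support_transfer]
    intro a ha hb
    simp only [List.mem_cons, List.not_mem_nil, or_false] at ha
    rcases ha with rfl | rfl
    · exact (hQ₃ _ hb).1 rfl
    · exact (hQ₃ _ hb).2 rfl
  -- apply the core and evaluate
  have key := h G hGzd hGfin u w z p hI hD1 hD2
  rw [pathKernel_comm G x w p, pathKernel_comm G x z p, K1, K2, K3] at key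
  replace key := key.trans (mul_le_mul' K4 le_rfl)
  -- finiteness and passage to `ℝ`
  have ha_top : pathKernel GA x u z ≠ ⊤ := by rw [← F1]; exact pathKernel_ne_top hfin x u z
  have hb_top : pathKernel GA x w z ≠ ⊤ := by
    rw [← mul_one (pathKernel GA x w z), ← pathKernel_self GB x z, ← hF w z hwA hzB]
    exact pathKernel_ne_top hfin x w z
  have hc_top : pathKernel H x u w ≠ ⊤ := pathKernel_ne_top hfin x u w
  have hβ_top : pathKernel H x z u' ≠ ⊤ := pathKernel_ne_top hfin x z u'
  set a := pathKernel GA x u z with ha_def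
  set b := pathKernel GA x w z with hb_def
  set c := pathKernel H x u w with hc_def
  set β := pathKernel H x z u' with hβ_def
  have haa : a = ENNReal.ofReal a.toReal := (ENNReal.ofReal_toReal ha_top).symm
  have hbb : b = ENNReal.ofReal b.toReal := (ENNReal.ofReal_toReal hb_top).symm
  have hcc : c = ENNReal.ofReal c.toReal := (ENNReal.ofReal_toReal hc_top).symm
  have hββ : β = ENNReal.ofReal β.toReal := (ENNReal.ofReal_toReal hβ_top).symm
  set a' := a.toReal with ha'_def
  set b' := b.toReal with hb'_def
  set c' := c.toReal with hc'_def
  set β' := β.toReal with hβ'_def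
  have ha'0 : 0 ≤ a' := ENNReal.toReal_nonneg
  have hb'0 : 0 ≤ b' := ENNReal.toReal_nonneg
  have hc'0 : 0 ≤ c' := ENNReal.toReal_nonneg
  have hβ'0 : 0 < β' := ENNReal.toReal_pos hβ hβ_top
  rw [haa, hbb, hcc, hββ] at key
  rw [haa, hbb, hcc]
  have e1 : ENNReal.ofReal a' + ENNReal.ofReal (x ^ 2) * ENNReal.ofReal β' =
      ENNReal.ofReal (a' + x ^ 2 * β') := by
    rw [ENNReal.ofReal_add ha'0 (mul_nonneg (pow_nonneg hxle 2) hβ'0.le),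
      ENNReal.ofReal_mul (pow_nonneg hxle 2)]
  have e2 : ENNReal.ofReal x * (ENNReal.ofReal c' + ENNReal.ofReal b' * ENNReal.ofReal β') =
      ENNReal.ofReal (x * (c' + b' * β')) := by
    rw [ENNReal.ofReal_mul hxle, ENNReal.ofReal_add hc'0 (mul_nonneg hb'0 hβ'0.le),
      ENNReal.ofReal_mul hb'0]
  have e3 : ENNReal.ofReal c' + ENNReal.ofReal (x ^ 2) * (ENNReal.ofReal b' * ENNReal.ofReal β') =
      ENNReal.ofReal (c' + x ^ 2 * (b' * β')) := by
    rw [ENNReal.ofReal_add hc'0 (mul_nonneg (pow_nonneg hxle 2) (mul_nonneg hb'0 hβ'0.le)),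
      ENNReal.ofReal_mul (pow_nonneg hxle 2), ENNReal.ofReal_mul hb'0]
  have e4 : ENNReal.ofReal x * (ENNReal.ofReal a' + ENNReal.ofReal β') =
      ENNReal.ofReal (x * (a' + β')) := by
    rw [ENNReal.ofReal_mul hxle, ENNReal.ofReal_add ha'0 hβ'0.le]
  rw [e1, e2, e3, e4, ← ENNReal.ofReal_mul (by positivity), ← ENNReal.ofReal_mul (by positivity),
    ENNReal.ofReal_le_ofReal_iff (by positivity)] at key
  -- `key : (a' + x² β') · x (c' + b' β') ≤ (c' + x² b' β') · x (a' + β')` over `ℝ`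
  have hkey : x * β' * (1 - x ^ 2) * (a' * b') ≤ x * β' * (1 - x ^ 2) * c' := by nlinarith [key]
  have hx2 : 0 < 1 - x ^ 2 := by nlinarith
  have hab : a' * b' ≤ c' := le_of_mul_le_mul_left hkey (by positivity)
  rw [← ENNReal.ofReal_mul ha'0]
  exact ENNReal.ofReal_le_ofReal hab

end Summit.CriticalPhenomena.SAWScalingLimit.Theorems.LeftRightFKG.CornerGadget
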